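import Summits.BirchSwinnertonDyer.BirchSwinnertonDyer.Theorems.GoldfeldAllTwistsTwoConverseTwinEvenTwistLocalPOne
import HarnessLib

set_option linter.dupNamespace false -- namespace `…BirchSwinnertonDyer.BirchSwinnertonDyer…` is the cell's (D-0017 nested layout)
set_option autoImplicit false

/-!
# Cell C7 (β, `p ≡ 1 (mod 8)`), file F1 = (M7a): the `2`-isogeny Selmer LOWER bound of the even partner `49a1^{(2p)}` —
# `p ∈ S' = S(−84p, −28p²)`, `#S' ≥ 4`, hence rank `0` ⇒ `Ш(49a1^{(2p)})[2] ≠ 0`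

Cell `bsd-goldfeld`, seat `bsd-goldfeld-s1p-c3x` (gen 12); planner ORDER «C7-SCOPING» (RULING (cccxxvi)), memo `HOME/C7-HORIZON.md` §2 (M7a) /
§4 F1 (part b, the Selmer set and `Ш`; part a = `…TwinEvenTwistLocalPOne`, the local solubility) — the STOP/GO file of the C7 line. `--supports stmt-BirchSwinnertonDyer-20044` as a HELPER (planner RULING (cccxxxviii), TRANCHE C7-1). Theses-free; theorems only; no definition,
no named fact, no `sorry`: FACT-FREE (UNCONDITIONAL).

OBJECT. For a prime `p ≡ 1 (mod 8)` with `(−7/p) = +1` and `−7` a fourth power mod `p` (type β) — cell C7 of the mixed two-prime family — the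
two-torsion model `E_{2p} : y² = x³ + 42p·x² + 448p²·x` of `49a1^{(2p)}` has `S' = S(−84p, −28p²) ∋ p`: the homogeneous space
`w² = p u⁴ − 84p u²z² − 28p z⁴` is everywhere locally soluble (`prime_mem_twoIsogenySelmerGroup'_twoPosTwist_pOne`). With `1` and `−7`
(`(−28p²)/(−7) = (2p)²`) this gives **`4 ≤ #S'`** (`four_le_card_twoIsogenySelmerGroup'_twoPosTwist_pOne`; `#S'` is a power of `2`), and
Silverman's count `2^{dim S'} = #α'(E'(ℚ))·#Ш(E)[Ξ]` with `#α(E(ℚ))·#α'(E'(ℚ)) = 2^{rank + 2}`, `#α ≥ 2` (`α(T) = [448p²] = [7] ≠ 1`) gives,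
WHEN `rank E_{2p}(ℚ) = 0`, a non-zero class of `Ш(E_{2p})` killed by `2` (`exists_mem_sha_two_twoTorsionModel_twoPosTwist_pOne`), transported to
every model `W` of `49a1^{(2p)}` (`exists_mem_sha_two_twoPosTwist_pOne`). This is the flipped bit (M7) of the C7 line: on C4/C6/C8
(`p ≡ 5 (mod 8)`) LINE C3 proved `#S ≤ 2`, `#S' ≤ 2`, `Ш[2] = 0`; on C7 `(#S, #S') = (8, 4)` (kit j312848/j312976, 70/70) and `Ш[2] ≠ 0`
whenever `L(49a1^{(2p)}, 1) ≠ 0`.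

LOCAL SOLUBILITY of `w² = p u⁴ − 84p u²z² − 28p z⁴` (the template is the tree's `LindMordellQuarticsHassePrincipleFailure`, `S^{(φ)}(y² = x³ + px)`
for `p ≡ 1 (mod 8)`): over `ℝ` the point `(1, 0, √p)`; at a prime `ℓ ≥ 5`, `ℓ ∉ {7, p}`: good reduction, `Δ = −2²⁶·7³·p⁶`, the tree's PROVED
`BinaryQuartic.isSoluble_padic_of_not_dvd_disc`; at `ℓ = 3`: `(1, 0, √p)` if `p ≡ 1 (mod 3)`, `(0, 1, √(−28p))` if `p ≡ 2 (mod 3)`; at `ℓ = 7`: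
`(1, 0, √p)`, `(p/7) = +1`; at `ℓ = 2`: `(1, 0, √p)`, `p ≡ 1 (mod 8)` a `2`-adic square; at `ℓ = p` (the ONLY place where type β enters): the ROOT
`t₀ = c³ + 3c` of `g(t) = t⁴ − 84t² − 28 = (t² − 42)² − 2⁸·7` modulo `p`, where `c⁴ = 7` (`c = x(1+i)/a`, `x⁴ = −7`, `i² = −1`, `a² = 2`),
`g(t₀) = (c⁸ + 12c⁶ + 61c⁴ + 108c² + 4)(c⁴ − 7) = 0`, `g'(t₀) = 4t₀(t₀² − 42) = 64c³(c² + 3) ≠ 0`, lifts by Hensel (the tree's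
`BinaryQuartic.exists_eval_eq_zero_of_simple_root`) to `t ∈ ℤ_p` with `g(t) = 0`, i.e. the point `(t, 1, 0)`.

NUMERICS (kit j312848 + j312976, PARI 2.17.3; evidence on item 19140): all 70 C7 rows with `qp ≤ 150000` have `S(42p, 448p²) = {1,2,7,14,p,2p,7p,14p}`,
`S' = {1, −7, p, −7p}`, and `r_an(49a1^{(2p)}) = 0 ⇒ ord₂(L/Ω) ∈ {5,7,9}` / `r_an = 2` otherwise. HONEST FRAMING: arithmetic of the even partner on a
density-zero family; no Heegner point, no `L`-value, no case of K12₂″ / twin″ decided; BSD is not proved by any of this.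

References: Silverman, *AEC* (2009), Thm. X.4.2(a), Prop. X.4.9, Prop. X.6.2(b), X.6.5 [SilvermanAEC2009]; Silverman–Tate (2015) §3.5–3.6 [SilvermanTate2015];
Bhargava–Shankar, Ann. of Math. 181 (2015), proof of Prop. 3.18 (Hensel step) [BhargavaShankarAnnals2015].
-/

noncomputable section

open scoped Classical

open WeierstrassCurve Literature.NumberTheory Literature.NumberTheory.EllipticCurves
open WeierstrassCurve.Affine (sqClass sqClass_eq_one_iff)

namespace Summit.BirchSwinnertonDyer.BirchSwinnertonDyer.Theorems.GoldfeldGoodTwists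

/-! ## §3 `p ∈ S'`, `4 ≤ #S'` -/

section Selmer

variable {p : ℕ} [Fact p.Prime]

/-- **`p ∈ S' = S(−84p, −28p²)`** for the two-torsion model `E_{2p} = [0, 42p, 0, 448p², 0]` of `49a1^{(2p)}`, `p ≡ 1 (mod 8)`, `(−7/p) = +1`,
type β. [cite: SilvermanAEC2009, Prop. X.4.9] -/
theorem prime_mem_twoIsogenySelmerGroup'_twoPosTwist_pOne (hp8 : p % 8 = 1) (hp7 : legendreSym p (-7) = 1)
    (hβ : ∃ x : ZMod p, x ^ 4 = -7) : (p : ℤ) ∈ twoIsogenySelmerGroup' (42 * p) (448 * p ^ 2) := by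
  have hp : p.Prime := Fact.out
  have hp0 : (p : ℤ) ≠ 0 := by exact_mod_cast hp.ne_zero
  have hb : (-28 * (p : ℤ) ^ 2) ≠ 0 := mul_ne_zero (by norm_num) (pow_ne_zero 2 hp0)
  rw [twoIsogenySelmerGroup'_eq, show (-2 * (42 * (p : ℤ))) = -84 * p by ring,
    show ((42 * (p : ℤ)) ^ 2 - 4 * (448 * (p : ℤ) ^ 2)) = -28 * (p : ℤ) ^ 2 by ring, mem_twoIsogenySelmerGroup_iff hb,
    show (-28 * (p : ℤ) ^ 2) / (p : ℤ) = -28 * p from Int.ediv_eq_of_eq_mul_left hp0 (by ring)]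
  exact ⟨(Int.squarefree_natCast.mpr hp.squarefree), ⟨-28 * p, by ring⟩, isLocallySoluble_quartic_pOne hp8 hp7 hβ⟩

omit [Fact p.Prime] in
/-- `−7 ∈ S'`: the image of `T'` (`(−28p²)/(−7) = (2p)²`). [cite: SilvermanAEC2009, Prop. X.4.9] -/
theorem neg_seven_mem_twoIsogenySelmerGroup'_twoPosTwist (hp : 0 < p) : (-7 : ℤ) ∈ twoIsogenySelmerGroup' (42 * p) (448 * p ^ 2) := by
  have hp0 : (p : ℤ) ≠ 0 := by exact_mod_cast hp.ne'
  have hb : (-28 * (p : ℤ) ^ 2) ≠ 0 := mul_ne_zero (by norm_num) (pow_ne_zero 2 hp0)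
  rw [twoIsogenySelmerGroup'_eq, show (-2 * (42 * (p : ℤ))) = -84 * p by ring,
    show ((42 * (p : ℤ)) ^ 2 - 4 * (448 * (p : ℤ) ^ 2)) = -28 * (p : ℤ) ^ 2 by ring]
  have h7 : Squarefree (-7 : ℤ) :=
    (Int.squarefree_natCast.mpr (by norm_num : Nat.Prime 7).squarefree).squarefree_of_dvd ⟨-1, by norm_num⟩
  refine mem_twoIsogenySelmerGroup_of_isSquare hb h7 ⟨4 * (p : ℤ) ^ 2, by ring⟩ ⟨2 * p, ?_⟩
  rw [show (-28 * (p : ℤ) ^ 2) / (-7 : ℤ) = 4 * (p : ℤ) ^ 2 from Int.ediv_eq_of_eq_mul_left (by norm_num) (by ring)]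
  ring

/-- **`4 ≤ #S'`** (`{1, −7, p} ⊆ S'` and `#S'` is a power of `2`). [cite: SilvermanAEC2009, Prop. X.4.9] -/
theorem four_le_card_twoIsogenySelmerGroup'_twoPosTwist_pOne (hp8 : p % 8 = 1) (hp7 : legendreSym p (-7) = 1)
    (hβ : ∃ x : ZMod p, x ^ 4 = -7) : 4 ≤ (twoIsogenySelmerGroup' (42 * p) (448 * p ^ 2)).card := by
  have hp : p.Prime := Fact.out
  have hp0 : (p : ℤ) ≠ 0 := by exact_mod_cast hp.ne_zero
  have hsub : ({1, -7, (p : ℤ)} : Finset ℤ) ⊆ twoIsogenySelmerGroup' (42 * p) (448 * p ^ 2) := by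
    intro d hd
    simp only [Finset.mem_insert, Finset.mem_singleton] at hd
    rcases hd with rfl | rfl | rfl
    · rw [twoIsogenySelmerGroup'_eq]
      exact one_mem_twoIsogenySelmerGroup _ (by
        rw [show ((42 * (p : ℤ)) ^ 2 - 4 * (448 * (p : ℤ) ^ 2)) = -28 * (p : ℤ) ^ 2 by ring]
        exact mul_ne_zero (by norm_num) (pow_ne_zero 2 hp0))
    · exact neg_seven_mem_twoIsogenySelmerGroup'_twoPosTwist hp.pos
    · exact prime_mem_twoIsogenySelmerGroup'_twoPosTwist_pOne hp8 hp7 hβ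
  have h3 : 3 ≤ (twoIsogenySelmerGroup' (42 * p) (448 * p ^ 2)).card := by
    have hp1 : (p : ℤ) ≠ 1 := by exact_mod_cast hp.one_lt.ne'
    have hp7' : (p : ℤ) ≠ -7 := by have := hp.pos; omega
    have hcard : ({1, -7, (p : ℤ)} : Finset ℤ).card = 3 := by
      rw [Finset.card_insert_of_notMem (by
            simp only [Finset.mem_insert, Finset.mem_singleton, not_or]; exact ⟨by norm_num, fun h => hp1 h.symm⟩),
        Finset.card_insert_of_notMem (by simp only [Finset.mem_singleton]; exact fun h => hp7' h.symm), Finset.card_singleton]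
    exact hcard ▸ Finset.card_le_card hsub
  obtain ⟨k, hk⟩ : ∃ k, (twoIsogenySelmerGroup' (42 * p) (448 * p ^ 2)).card = 2 ^ k :=
    ⟨_, (two_pow_twoIsogenySelmerRank'_eq_card (hab_twoPosTwist hp.pos)).symm⟩
  rw [hk] at h3 ⊢
  have hk2 : 2 ≤ k := by
    by_contra hlt
    interval_cases k <;> norm_num at h3
  calc (4 : ℕ) = 2 ^ 2 := by norm_num
    _ ≤ 2 ^ k := Nat.pow_le_pow_right two_pos hk2

end Selmer

/-! ## §4 Rank `0` ⇒ `Ш[2] ≠ 0` -/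

section Sha

/-- **A Selmer LOWER bound forces `Ш`**: for `E = E_{a,b}` over `ℚ` with `b(a² − 4b) ≠ 0`, `b` NOT a square (so `#α(E(ℚ)) ≥ 2`), `#S'(a,b) ≥ 4`
and `rank E(ℚ) = 0`: `Ш(E/ℚ)` has a non-zero class killed by `2` — from `2^{dim S'} = #α'(E'(ℚ))·#(Ш(E) ⊓ im Ξ)` and
`#α(E(ℚ))·#α'(E'(ℚ)) = 2^{rank + 2}`. [cite: SilvermanAEC2009, Thm. X.4.2(a) and Prop. X.4.9] [cite: SilvermanTate2015, §3.6] -/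
theorem exists_mem_sha_two_of_four_le_card_selmer' {a b : ℤ} (hab : b * (a ^ 2 - 4 * b) ≠ 0)
    [hE : (⟨0, (a : ℚ), 0, (b : ℚ), 0⟩ : WeierstrassCurve ℚ).IsElliptic] (hbsq : ¬ IsSquare (b : ℚ))
    (hS' : 4 ≤ (twoIsogenySelmerGroup' a b).card) (hrk : (⟨0, (a : ℚ), 0, (b : ℚ), 0⟩ : WeierstrassCurve ℚ).mordellWeilRank = 0) :
    ∃ c ∈ (⟨0, (a : ℚ), 0, (b : ℚ), 0⟩ : WeierstrassCurve ℚ).sha, c ≠ 0 ∧ 2 • c = 0 := by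
  set E : WeierstrassCurve ℚ := ⟨0, (a : ℚ), 0, (b : ℚ), 0⟩ with hEdef
  have hb0 : (b : ℚ) ≠ 0 := by
    have : b ≠ 0 := fun h ↦ hab (by rw [h, zero_mul]); exact_mod_cast this
  -- the two counts
  have key := two_pow_twoIsogenySelmerRank'_eq_natCard_mul hab (hE := hE)
  have cnt := natCard_range_xSqClass_mul E
  rw [twoIsogenyCodomain_mk_intCast, hrk, zero_add] at cnt
  rw [two_pow_twoIsogenySelmerRank'_eq_card hab] at key
  -- `#α(E(ℚ)) ≥ 2`: `α(O) = 1 ≠ [b] = α(T)`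
  have hT : E.xSqClass E.twoTorsionPoint = sqClass (b : ℚ) := xSqClass_twoTorsionPoint E
  have hne : sqClass (b : ℚ) ≠ 1 := by
    intro h
    obtain ⟨u, hu⟩ := (sqClass_eq_one_iff hb0).mp h
    exact hbsq ⟨u, by rw [hu]; ring⟩
  haveI hfinα : Finite (Set.range E.xSqClass) := by
    apply Nat.finite_of_card_ne_zero
    intro h0; rw [h0, zero_mul] at cnt; norm_num at cnt
  have hα : 2 ≤ Nat.card (Set.range E.xSqClass) := by
    have hnt : Nontrivial (Set.range E.xSqClass) :=
      ⟨⟨⟨1, 0, xSqClass_zero E⟩, ⟨sqClass (b : ℚ), E.twoTorsionPoint, hT⟩, fun h ↦ hne.symm (congrArg Subtype.val h)⟩⟩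
    exact Finite.one_lt_card_iff_nontrivial.mpr hnt
  -- hence `#α' ≤ 2` and `#(Ш ⊓ im Ξ) ≥ 2`
  have hα' : Nat.card (Set.range (⟨0, ((-2 * a : ℤ) : ℚ), 0, ((a ^ 2 - 4 * b : ℤ) : ℚ), 0⟩ : WeierstrassCurve ℚ).xSqClass) ≤ 2 := by
    by_contra hlt
    have h3 : 3 ≤ Nat.card (Set.range (⟨0, ((-2 * a : ℤ) : ℚ), 0, ((a ^ 2 - 4 * b : ℤ) : ℚ), 0⟩ : WeierstrassCurve ℚ).xSqClass) := by omega
    have h6 := Nat.mul_le_mul hα h3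
    rw [cnt] at h6
    norm_num at h6
  have hSha : 2 ≤ Nat.card ↥(E.sha ⊓ E.twoIsogenyTorsorHom.range) := by
    by_contra hlt
    have hle : Nat.card ↥(E.sha ⊓ E.twoIsogenyTorsorHom.range) ≤ 1 := by omega
    have : (twoIsogenySelmerGroup' a b).card ≤ 2 := by
      rw [key]; nlinarith [hα', hle, Nat.zero_le (Nat.card ↥(E.sha ⊓ E.twoIsogenyTorsorHom.range))]
    omega
  haveI : Finite ↥(E.sha ⊓ E.twoIsogenyTorsorHom.range) := Nat.finite_of_card_ne_zero (by omega)
  haveI := Finite.one_lt_card_iff_nontrivial.mp hSha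
  obtain ⟨⟨c, hc⟩, hc1⟩ := exists_ne (0 : ↥(E.sha ⊓ E.twoIsogenyTorsorHom.range))
  obtain ⟨hcsha, hcr⟩ := AddSubgroup.mem_inf.mp hc
  obtain ⟨x, hx⟩ := hcr
  refine ⟨c, hcsha, fun h ↦ hc1 (Subtype.ext h), ?_⟩
  rw [← hx]
  exact two_nsmul_twoIsogenyTorsorHom E x

variable {p : ℕ} [Fact p.Prime]

/-- `448p² = 7·(8p)²` is not a rational square (`p ≠ 7`). [folklore] -/
private theorem not_isSquare_b (hp7 : p ≠ 7) : ¬ IsSquare (((112 * (2 * (p : ℤ)) ^ 2 : ℤ)) : ℚ) := by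
  have hp : p.Prime := Fact.out
  rw [Rat.isSquare_intCast_iff]
  rintro ⟨s, hs⟩
  have h7 : (7 : ℤ) ∣ s * s := ⟨64 * (p : ℤ) ^ 2, by rw [← hs]; ring⟩
  have h7s : (7 : ℤ) ∣ s := (Int.Prime.dvd_mul' (by norm_num) h7).elim id id
  obtain ⟨k, rfl⟩ := h7s
  have h49 : (7 : ℤ) ∣ 64 * (p : ℤ) ^ 2 := ⟨k * k, by linarith⟩
  rcases Int.Prime.dvd_mul' (by norm_num) h49 with h | h
  · norm_num at h
  · have h7p : (7 : ℤ) ∣ (p : ℤ) := Int.Prime.dvd_pow' (by norm_num) h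
    exact hp7 ((Nat.prime_dvd_prime_iff_eq (by norm_num) hp).mp (by exact_mod_cast h7p)).symm

/-- **Rank `0` ⇒ `Ш(E_{2p})[2] ≠ 0`** for the two-torsion model `E_{2p} = [0, 21·(2p), 0, 112·(2p)², 0]` of `49a1^{(2p)}`, `p ≡ 1 (mod 8)`,
`(−7/p) = +1`, type β. [cite: SilvermanAEC2009, Thm. X.4.2(a) and Prop. X.4.9] -/
theorem exists_mem_sha_two_twoTorsionModel_twoPosTwist_pOne (hp8 : p % 8 = 1) (hp7 : legendreSym p (-7) = 1)
    (hβ : ∃ x : ZMod p, x ^ 4 = -7)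
    [hE : (⟨0, ((21 * (2 * (p : ℤ)) : ℤ) : ℚ), 0, ((112 * (2 * (p : ℤ)) ^ 2 : ℤ) : ℚ), 0⟩ : WeierstrassCurve ℚ).IsElliptic]
    (hrk : (⟨0, ((21 * (2 * (p : ℤ)) : ℤ) : ℚ), 0, ((112 * (2 * (p : ℤ)) ^ 2 : ℤ) : ℚ), 0⟩ : WeierstrassCurve ℚ).mordellWeilRank = 0) :
    ∃ c ∈ (⟨0, ((21 * (2 * (p : ℤ)) : ℤ) : ℚ), 0, ((112 * (2 * (p : ℤ)) ^ 2 : ℤ) : ℚ), 0⟩ : WeierstrassCurve ℚ).sha, c ≠ 0 ∧ 2 • c = 0 := by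
  have hp : p.Prime := Fact.out
  obtain ⟨-, -, hp7', -⟩ := aux_of_mod_eight_one hp8
  have hab := hab_posTwist (M := (2 * (p : ℤ))) (mul_ne_zero two_ne_zero (by exact_mod_cast hp.ne_zero))
  refine exists_mem_sha_two_of_four_le_card_selmer' hab (not_isSquare_b hp7') ?_ hrk
  rw [show (21 * (2 * (p : ℤ))) = 42 * p by ring, show (112 * (2 * (p : ℤ)) ^ 2) = 448 * p ^ 2 by ring]
  exact four_le_card_twoIsogenySelmerGroup'_twoPosTwist_pOne hp8 hp7 hβ

/-- **Rank `0` ⇒ `Ш(W)[2] ≠ 0` for EVERY model `W` of `49a1^{(2p)}`**, `p ≡ 1 (mod 8)` prime, `(−7/p) = +1`, type β (`Ш ⊓ H¹[2]` is transported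
along variable changes, `sha_inf_torsionBy_eq_bot_smul`). [cite: SilvermanAEC2009, Thm. X.4.2(a), Prop. X.4.9, III.3.1(b)] -/
theorem exists_mem_sha_two_twoPosTwist_pOne (hp8 : p % 8 = 1) (hp7 : legendreSym p (-7) = 1) (hβ : ∃ x : ZMod p, x ^ 4 = -7)
    (W : WeierstrassCurve ℚ) [W.IsElliptic] (C : VariableChange ℚ) (hC : C • W = cm7.quadraticTwist ((2 * (p : ℤ) : ℤ) : ℚ))
    (hrk : W.mordellWeilRank = 0) : ∃ c ∈ W.sha, c ≠ 0 ∧ 2 • c = 0 := by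
  have hp : p.Prime := Fact.out
  haveI hE := isElliptic_mk_of_ne_zero (F := ℚ)
    (hab_posTwist (M := (2 * (p : ℤ))) (mul_ne_zero two_ne_zero (by exact_mod_cast hp.ne_zero)))
  have hmodel := smul_eq_twoTorsionModel_of_smul_eq_quadraticTwist (2 * (p : ℤ)) W C hC
  set C' : VariableChange ℚ := (⟨(Units.mk0 (2 : ℚ) two_ne_zero)⁻¹, 2 * ((2 * (p : ℤ) : ℤ) : ℚ), 0, 0⟩ : VariableChange ℚ) * C with hC'
  -- rank is an isomorphism invariant
  have hrk' : (C' • W).mordellWeilRank = 0 := by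
    have h := mordellWeilRank_variableChange_holds W C'
    unfold mordellWeilRank_variableChange at h
    rw [← hrk]
    convert h using 2
  have hrkE : (⟨0, ((21 * (2 * (p : ℤ)) : ℤ) : ℚ), 0, ((112 * (2 * (p : ℤ)) ^ 2 : ℤ) : ℚ), 0⟩ : WeierstrassCurve ℚ).mordellWeilRank = 0 := by
    have transfer : ∀ {X Y : WeierstrassCurve ℚ} (_ : X = Y) [X.IsElliptic] [Y.IsElliptic], X.mordellWeilRank = 0 → Y.mordellWeilRank = 0 := by
      intro X Y h _ _ hX; subst h; convert hX
    exact transfer hmodel hrk'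
  obtain ⟨c, hc, hc0, hc2⟩ := exists_mem_sha_two_twoTorsionModel_twoPosTwist_pOne hp8 hp7 hβ hrkE
  -- `Ш ⊓ H¹[2] ≠ ⊥` descends from `C' • W` to `W`
  by_contra hW
  have hbot : (W.sha ⊓ AddSubgroup.torsionBy W.galH1 2 : AddSubgroup _) = ⊥ := by
    refine eq_bot_iff.mpr fun c hc ↦ ?_
    rw [AddSubgroup.mem_inf] at hc
    by_contra hne
    exact hW ⟨c, hc.1, fun h ↦ hne (AddSubgroup.mem_bot.mpr h), (AddSubgroup.torsionBy.nsmul_iff (n := 2)).mp hc.2⟩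
  have hbot' := sha_inf_torsionBy_eq_bot_smul W C' 2 hbot
  have transfer : ∀ {X Y : WeierstrassCurve ℚ} (_ : X = Y),
      (X.sha ⊓ AddSubgroup.torsionBy X.galH1 2 : AddSubgroup _) = ⊥ → ∀ c ∈ Y.sha, 2 • c = 0 → c = 0 := by
    intro X Y h hX c hc hn
    subst h
    have : c ∈ (X.sha ⊓ AddSubgroup.torsionBy X.galH1 2 : AddSubgroup _) :=
      AddSubgroup.mem_inf.mpr ⟨hc, (AddSubgroup.torsionBy.nsmul_iff (n := 2)).mpr hn⟩
    rw [hX] at this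
    exact AddSubgroup.mem_bot.mp this
  exact hc0 (transfer hmodel hbot' c hc hc2)

end Sha

end Summit.BirchSwinnertonDyer.BirchSwinnertonDyer.Theorems.GoldfeldGoodTwists

end
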